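import Literature.NumberTheory.EllipticCurves.PAdicTwoVariableCoherentFamiliesDiagonal
import HarnessLib

/-!
# Coherent families along `E_j` versus along the shifted tower `E_{i+c}`: `extendDown` and restriction are mutually inverse
# (de Shalit III.1.1–1.3: `U_∞ = lim←_{m,k} U_{m,k}` does not see a finite initial segment of the unramified direction)

Topic `NumberTheory/EllipticCurves`; namespace `Literature.NumberTheory.EllipticCurves`.  `PAdicTwoVariableRelNormCoherentUnitsOfGlobal §3` defined `extendDown`: a family on the
shifted tower `i ↦ E_{i+c}` is re-indexed to the whole tower `E_j` by norming down (`(extendDown β)_j = N_{E_{(j−c)+c}/E_j} β_{j−c}`), with `extendDown_mem_coherentFamilies`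
and `extendDown_add` (`(extendDown β)_{i+c} = β_i`).  With the iterated coherence of `PAdicTwoVariableCoherentFamiliesDiagonal` (`baseNorm_eq_of_mem_coherentFamilies`) THIS
file adds the converse: ★ `restrictShift_mem_coherentFamilies` (restriction `β ↦ (β_{i+c})_i` preserves coherence), ★★ `extendDown_restrictShift` (**`extendDown (β_{·+c}) = β`**
for `β ∈ coherentFamilies hπ E hmono`), `restrictShift_extendDown` (= `extendDown_add`), and the principal versions — so **`coherentFamilies hπ E hmono` ≅
`coherentFamilies hπ (E_{·+c})`**, `principalCoherentFamilies` likewise (`extendDown_principalPart_mem_principalCoherentFamilies` pattern: principal at `0` is preserved by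
norms).  Use (cell `bsd-print-cf2`, brick §4(c)/(e), memo BRICK-C-LOCALMODEL-g23 F43): the local model lands on the shifted tower `E_{n+r+1}`
(`PAdicTwoVariableLocalUnitsDiagonalFrame`); this file moves it to the (c)-capstone's full tower `E_j`.  Theorems only; no `sorry`.

## References
* [deShalit1987] E. de Shalit, *Iwasawa theory of elliptic curves with complex multiplication* (1987), Ch. I §3.8 (16)–(17); III.1.1–1.3 (p. 88–90).
-/

noncomputable section

namespace Literature.NumberTheory.EllipticCurves

open ValuativeRel IsLocalRing Field
open Literature.NumberTheory.GaloisRepresentations Literature.NumberTheory.GaloisRepresentations.IsNonarchimedeanLocalField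
  Literature.NumberTheory.GaloisRepresentations.LubinTate

variable {F : Type} [Field F] [ValuativeRel F] [TopologicalSpace F] [IsNonarchimedeanLocalField F]

attribute [local instance] ltNormUniformSpace ltNormIsUniformAddGroup rk1 nF nE fintypeResidueField

variable {π : 𝒪[F]} (hπ : (valuation F).IsUniformizer (π : F))
  (E : ℕ → IntermediateField F (AlgebraicClosure F)) [∀ m, FiniteDimensional F (E m)] [∀ m, IsGalois F (E m)] (hmono : Monotone E) (c : ℕ)

/-- Index transport for `baseNorm` (dependent types: `β_a` and `β_b` for `a = b`). [cite: deShalit1987, III.1.2 Lemma (ii) (p. 89)] -/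
theorem baseNorm_congr {β : ∀ m, RelNormCoherentUnits hπ (E m)} {a b : ℕ} (e : a = b) {j : ℕ} (ha : E j ≤ E a) (hb : E j ≤ E b) :
    (β a).baseNorm hπ ha = (β b).baseNorm hπ hb := by
  subst e; rfl

/-- ★ **Restriction to the shifted tower preserves coherence**: `(β_{i+c})_i ∈ coherentFamilies hπ (E_{·+c})`. [cite: deShalit1987, III.1.1 (p. 88)] -/
theorem restrictShift_mem_coherentFamilies {β : ∀ m, RelNormCoherentUnits hπ (E m)} (hβ : β ∈ coherentFamilies hπ E hmono) :
    (fun i ↦ β (i + c)) ∈ coherentFamilies hπ (fun i ↦ E (i + c)) (monotone_shift E hmono c) := by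
  intro i
  change (β (i + 1 + c)).baseNorm hπ (monotone_shift E hmono c (Nat.le_succ i)) = β (i + c)
  rw [baseNorm_congr hπ E (show i + 1 + c = i + c + 1 by omega) (monotone_shift E hmono c (Nat.le_succ i)) (hmono (Nat.le_succ (i + c)))]
  exact hβ (i + c)

/-- Restriction preserves principal families (`β_{i+c,0}` is principal). [cite: deShalit1987, Ch. I §3.8 (17)] -/
theorem restrictShift_mem_principalCoherentFamilies {β : ∀ m, RelNormCoherentUnits hπ (E m)} (hβ : β ∈ principalCoherentFamilies hπ E hmono) :
    (fun i ↦ β (i + c)) ∈ principalCoherentFamilies hπ (fun i ↦ E (i + c)) (monotone_shift E hmono c) :=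
  ⟨restrictShift_mem_coherentFamilies hπ E hmono c hβ.1, fun i ↦ hβ.2 (i + c)⟩

/-- ★★ **`extendDown (β_{·+c}) = β`** for a coherent family `β` along the whole tower: `(extendDown (β_{·+c}))_j = N_{E_{(j−c)+c}/E_j} β_{(j−c)+c} = β_j` by iterated coherence
(`baseNorm_eq_of_mem_coherentFamilies`, `j ≤ (j − c) + c`). [cite: deShalit1987, III.1.2 Lemma (ii), III.1.3 (p. 89–90)] -/
theorem extendDown_restrictShift {β : ∀ m, RelNormCoherentUnits hπ (E m)} (hβ : β ∈ coherentFamilies hπ E hmono) :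
    extendDown hπ E hmono c (fun i ↦ β (i + c)) = β := by
  funext j
  rw [extendDown_apply]
  exact baseNorm_eq_of_mem_coherentFamilies hπ E hmono hβ le_tsub_add

/-- `(extendDown β')_{i+c} = β'_i` (restriction ∘ extendDown = id; the tree's `extendDown_add`). [cite: deShalit1987, III.1.3 (p. 90)] -/
theorem restrictShift_extendDown (β' : ∀ i, RelNormCoherentUnits hπ (E (i + c))) :
    (fun i ↦ extendDown hπ E hmono c β' (i + c)) = β' :=
  funext fun i ↦ extendDown_add hπ E hmono c β' i

/-- ★★ **`coherentFamilies hπ E hmono` and `coherentFamilies hπ (E_{·+c})` correspond bijectively** under restriction / `extendDown`: a family on the shifted tower that is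
coherent comes from exactly one coherent family on the whole tower. [cite: deShalit1987, III.1.1–1.3 (p. 88–90)] -/
theorem existsUnique_mem_coherentFamilies_restrictShift_eq {β' : ∀ i, RelNormCoherentUnits hπ (E (i + c))}
    (hβ' : β' ∈ coherentFamilies hπ (fun i ↦ E (i + c)) (monotone_shift E hmono c)) :
    ∃! β : ∀ m, RelNormCoherentUnits hπ (E m), β ∈ coherentFamilies hπ E hmono ∧ (fun i ↦ β (i + c)) = β' := by
  refine ⟨extendDown hπ E hmono c β', ⟨extendDown_mem_coherentFamilies hπ E hmono c hβ', restrictShift_extendDown hπ E hmono c β'⟩, ?_⟩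
  rintro β ⟨hβ, rfl⟩
  exact (extendDown_restrictShift hπ E hmono c hβ).symm

/-- ★ The principal version: `extendDown` of a principal coherent family on the shifted tower is principal (norms of principal units are principal), and restriction of a
principal family is principal — `principalCoherentFamilies hπ E hmono ≅ principalCoherentFamilies hπ (E_{·+c})`. [cite: deShalit1987, Ch. I §3.8 (17), III.1.3 (p. 90)] -/
theorem extendDown_mem_principalCoherentFamilies_of_restrictShift {β' : ∀ i, RelNormCoherentUnits hπ (E (i + c))}
    (hβ' : β' ∈ principalCoherentFamilies hπ (fun i ↦ E (i + c)) (monotone_shift E hmono c)) :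
    extendDown hπ E hmono c β' ∈ principalCoherentFamilies hπ E hmono := by
  refine ⟨extendDown_mem_coherentFamilies hπ E hmono c hβ'.1, fun j ↦ ?_⟩
  rw [extendDown_apply]
  exact RelNormCoherentUnits.norm_val_zero_baseNorm_sub_one_lt hπ _ _ (hβ'.2 (j - c))

end Literature.NumberTheory.EllipticCurves

end
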